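import Summits.HubbardSuperconductivity.HubbardSuperconductivity.Theses.CooperPairDMottWalk
import Literature.MathematicalPhysics.QuantumLattice.FinDimSpectrumSectorGibbsLimit

/-!
# Route `CooperPairDMottWalk`, crux `CooperPairDMott` (stmt-HubbardSuperconductivity-1177):
# helpers toward clause (b), the UNIQUE two-hole ground state (stub `stub_uniqueTwoHoleGroundState`
# of the registered skeleton `Cruxes/CooperPairDMott/Lines/birth.lean`)

Clause (b) of the crux says: for `U ∈ [2,4]`, all small inter-plaquette hoppings `b > 0` and all
large sides `L = 4k + 4`, the ground state of the breathing torus `H_L(1,b,U)` in the sector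
`(N, S^z) = (L² − 2, 0)` (two holes in the `d`-Mott parent) is unique up to a scalar. The physics
(Tsai–Kivelson 2006, Yao–Tsai–Kivelson 2007): at `b = 0` the level is `(L/2)²`-fold degenerate (the
bound hole pair sits on any one plaquette); at order `b²` it splits into a pair band
`−2 t_pair (cos Kₓ + cos K_y)` on the `(L/2) × (L/2)` torus of plaquettes, whose bottom is
non-degenerate because the plaquette torus has EVEN side `2k + 2` (unique minimum at `K = 0` if
`t_pair > 0`, at `(π,π)` if `t_pair < 0`). An `L`-uniform proof needs the exact plaquette-translation
symmetry and an `L`-uniform, quasi-local effective pair Hamiltonian (second-order DEGENERATE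
perturbation theory of a flat band with locality control) — no printed theorem supplies this, and
nothing in this file claims it. What this file supplies, sorry-free:

* `eq_smul_of_eigenvector_of_gap_orthogonal` — the linear-algebra form in which any such argument
  concludes: if the quadratic form of `H` is `≥ E₁ > E₀` on the part of the sector orthogonal to ONE
  vector `Ω` (any vector), then `E₀`-eigenvectors in the sector are proportional;
  `isGroundStateInSector_unique_of_gap_orthogonal` is the `IsGroundStateInSector` version and
  `uniqueTwoHoleGroundState_of_gap_orthogonal` the reduction of stub U VERBATIM (same quantifier
  prefix) to this `L`-uniform gap hypothesis;
* `gap_orthogonal_of_blocks` — the bookkeeping "diagonalise by momentum": the gap on `Ω^⊥` follows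
  from a gap in every block of an orthogonal, `H`-decoupled resolution of the sector (e.g. the
  isotypic components of the plaquette translations) plus a gap above `Ω` inside its own block;
* `gap_orthogonal_add_of_form_bound`, `minEnergyOn_add_le_of_eigenvector`,
  `isGroundStateInSector_unique_of_gap_orthogonal_add` — uniqueness is open in the couplings at
  fixed size (form-bounded perturbations `2ε < E₁ − E₀`), with the caveat that this can neither
  reach `b → 0` at fixed `L` (degenerate start) nor be uniform in `L` (`E₁ − E₀ ∼ b²/L²`);
* (companion file `CooperPairDMottWalkBreathingPlaquetteTranslations`) the SYMMETRY the band
  argument rests on: even translations of the `L × L` torus preserve the plaquette tiling, so the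
  plaquette translations commute with the breathing Hamiltonian, act on its sector ground states,
  and a UNIQUE sector ground state carries a definite plaquette momentum.

Sources: W.-F. Tsai, S. A. Kivelson, PRB 73 (2006) 214510; H. Yao, W.-F. Tsai, S. A. Kivelson,
PRB 76 (2007) 161104 (checkerboard Hubbard model, plaquette pair band); T. Kato, *Perturbation
Theory for Linear Operators* (1966) §II.2 (reduction of a degenerate eigenvalue); the lemmas
themselves are folklore linear algebra and lattice bookkeeping. No definition is introduced.
-/

set_option linter.dupNamespace false -- the route namespace `HubbardSuperconductivity.HubbardSuperconductivity` is mandated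

namespace Summit.HubbardSuperconductivity.HubbardSuperconductivity.Theorems.CooperPairDMottWalk

open Matrix
open scoped ComplexOrder
open Literature.Hubbard Literature.MathematicalPhysics.QuantumLattice
open Summit.HubbardSuperconductivity.HubbardSuperconductivity.Theses.CooperPairDMottWalk

section Generic

variable {ι : Type*} [Fintype ι]

/-- **An eigenvector below a gap is zero.** If the quadratic form of `H` is `≥ E₁` on the part of
the subspace `K` orthogonal to a vector `Ω`, then every eigenvector of `H` in `K` orthogonal to `Ω`
with a real eigenvalue `E₀ < E₁` vanishes. [folklore] -/
theorem eigenvector_eq_zero_of_gap_orthogonal (H : Matrix ι ι ℂ) (K : Submodule ℂ (ι → ℂ))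
    {E₀ E₁ : ℝ} (hE : E₀ < E₁) (Ω : ι → ℂ)
    (hgap : ∀ ψ ∈ K, star Ω ⬝ᵥ ψ = 0 → E₁ * (star ψ ⬝ᵥ ψ).re ≤ (star ψ ⬝ᵥ H *ᵥ ψ).re)
    {ψ : ι → ℂ} (hψK : ψ ∈ K) (hΩ : star Ω ⬝ᵥ ψ = 0) (hψ : H *ᵥ ψ = (E₀ : ℂ) • ψ) :
    ψ = 0 := by
  have h1 := hgap ψ hψK hΩ
  rw [hψ, dotProduct_smul, smul_eq_mul, Complex.re_ofReal_mul] at h1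
  obtain ⟨hre, him⟩ := Complex.nonneg_iff.mp (dotProduct_star_self_nonneg ψ)
  have hn0 : (star ψ ⬝ᵥ ψ).re = 0 := by nlinarith
  have h0 : star ψ ⬝ᵥ ψ = 0 := Complex.ext (by simpa using hn0) (by simpa using him.symm)
  exact dotProduct_star_self_eq_zero.mp h0

/-- **Uniqueness of the lowest eigenvector from a gap on `Ω^⊥`.** Let `K` be a subspace, `Ω` any
vector and `E₀ < E₁` real numbers such that the quadratic form of `H` is `≥ E₁ ‖ψ‖²` for all
`ψ ∈ K` orthogonal to `Ω`. Then any two eigenvectors of `H` in `K` with eigenvalue `E₀`, the first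
one nonzero, are proportional: the eigenspace meets `Ω^⊥ ∩ K` only in `0`, so it is at most
one-dimensional. (No hermiticity or invariance of `K` is needed.) [folklore] -/
theorem eq_smul_of_eigenvector_of_gap_orthogonal (H : Matrix ι ι ℂ) (K : Submodule ℂ (ι → ℂ))
    {E₀ E₁ : ℝ} (hE : E₀ < E₁) (Ω : ι → ℂ)
    (hgap : ∀ ψ ∈ K, star Ω ⬝ᵥ ψ = 0 → E₁ * (star ψ ⬝ᵥ ψ).re ≤ (star ψ ⬝ᵥ H *ᵥ ψ).re)
    {φ₁ φ₂ : ι → ℂ} (h₁K : φ₁ ∈ K) (h₂K : φ₂ ∈ K) (h₁0 : φ₁ ≠ 0)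
    (h₁ : H *ᵥ φ₁ = (E₀ : ℂ) • φ₁) (h₂ : H *ᵥ φ₂ = (E₀ : ℂ) • φ₂) :
    ∃ c : ℂ, φ₂ = c • φ₁ := by
  set a : ℂ := star Ω ⬝ᵥ φ₁ with ha
  set b : ℂ := star Ω ⬝ᵥ φ₂ with hb
  -- the combination `a • φ₂ - b • φ₁` is an `E₀`-eigenvector in `K` orthogonal to `Ω`, hence zero
  have hψK : a • φ₂ - b • φ₁ ∈ K := K.sub_mem (K.smul_mem a h₂K) (K.smul_mem b h₁K)
  have hψΩ : star Ω ⬝ᵥ (a • φ₂ - b • φ₁) = 0 := by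
    rw [dotProduct_sub, dotProduct_smul, dotProduct_smul, smul_eq_mul, smul_eq_mul, ← ha, ← hb]
    ring
  have hψ : H *ᵥ (a • φ₂ - b • φ₁) = (E₀ : ℂ) • (a • φ₂ - b • φ₁) := by
    rw [mulVec_sub, mulVec_smul, mulVec_smul, h₁, h₂, smul_sub, smul_comm (E₀ : ℂ) a φ₂,
      smul_comm (E₀ : ℂ) b φ₁]
  have hzero := eigenvector_eq_zero_of_gap_orthogonal H K hE Ω hgap hψK hψΩ hψ
  by_cases ha0 : a = 0
  · -- then `φ₁` itself is orthogonal to `Ω`, hence zero: contradiction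
    exfalso
    exact h₁0 (eigenvector_eq_zero_of_gap_orthogonal H K hE Ω hgap h₁K (by rw [← ha, ha0]) h₁)
  · refine ⟨b / a, ?_⟩
    have h : a • φ₂ = b • φ₁ := sub_eq_zero.mp hzero
    calc φ₂ = a⁻¹ • (a • φ₂) := by rw [smul_smul, inv_mul_cancel₀ ha0, one_smul]
      _ = (b / a) • φ₁ := by rw [h, smul_smul, div_eq_inv_mul]

/-- **The gap on `Ω^⊥` from a block decomposition** (the bookkeeping behind "diagonalise by
momentum"). Let `P j`, `j : J`, be operators which on the subspace `K` resolve the identity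
(`∑ j, P j ψ = ψ`), with mutually orthogonal ranges not coupled by `H` (e.g. the isotypic
projections of a finite abelian symmetry group of `H`, such as the plaquette translations). Suppose
`Ω` is orthogonal to every block but `j₀`, the quadratic form of `H` is `≥ E₁` on every block
`j ≠ j₀`, and `≥ E₁` on the part of block `j₀` orthogonal to `Ω`. Then it is `≥ E₁` on all of
`Ω^⊥ ∩ K` — the hypothesis of `eq_smul_of_eigenvector_of_gap_orthogonal`. [folklore] -/
theorem gap_orthogonal_of_blocks {J : Type*} [Fintype J] [DecidableEq J]
    (H : Matrix ι ι ℂ) (K : Submodule ℂ (ι → ℂ)) (P : J → Matrix ι ι ℂ) (j₀ : J) (Ω : ι → ℂ)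
    (E₁ : ℝ) (hsum : ∀ ψ ∈ K, ∑ j, P j *ᵥ ψ = ψ)
    (horth : ∀ i j, i ≠ j → ∀ ψ ∈ K, star (P i *ᵥ ψ) ⬝ᵥ (P j *ᵥ ψ) = 0)
    (hblock : ∀ i j, i ≠ j → ∀ ψ ∈ K, star (P i *ᵥ ψ) ⬝ᵥ (H *ᵥ (P j *ᵥ ψ)) = 0)
    (hΩ : ∀ j, j ≠ j₀ → ∀ ψ ∈ K, star Ω ⬝ᵥ (P j *ᵥ ψ) = 0)
    (hother : ∀ j, j ≠ j₀ → ∀ ψ ∈ K,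
      E₁ * (star (P j *ᵥ ψ) ⬝ᵥ (P j *ᵥ ψ)).re ≤ (star (P j *ᵥ ψ) ⬝ᵥ (H *ᵥ (P j *ᵥ ψ))).re)
    (hj₀ : ∀ ψ ∈ K, star Ω ⬝ᵥ (P j₀ *ᵥ ψ) = 0 →
      E₁ * (star (P j₀ *ᵥ ψ) ⬝ᵥ (P j₀ *ᵥ ψ)).re ≤ (star (P j₀ *ᵥ ψ) ⬝ᵥ (H *ᵥ (P j₀ *ᵥ ψ))).re) :
    ∀ ψ ∈ K, star Ω ⬝ᵥ ψ = 0 → E₁ * (star ψ ⬝ᵥ ψ).re ≤ (star ψ ⬝ᵥ H *ᵥ ψ).re := by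
  intro ψ hψ hΩψ
  -- `Ω ⊥ ψ` forces `Ω ⊥ P j₀ ψ`
  have hΩ₀ : star Ω ⬝ᵥ (P j₀ *ᵥ ψ) = 0 := by
    have h : star Ω ⬝ᵥ (∑ j, P j *ᵥ ψ) = 0 := by rw [hsum ψ hψ]; exact hΩψ
    rw [dotProduct_sum, Finset.sum_eq_single j₀ (fun j _ hj => hΩ j hj ψ hψ)
      (fun h => absurd (Finset.mem_univ j₀) h)] at h
    exact h
  -- Pythagoras for the norm and for the energy
  have hnorm : star ψ ⬝ᵥ ψ = ∑ j, star (P j *ᵥ ψ) ⬝ᵥ (P j *ᵥ ψ) := by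
    calc star ψ ⬝ᵥ ψ = star (∑ i, P i *ᵥ ψ) ⬝ᵥ (∑ j, P j *ᵥ ψ) := by rw [hsum ψ hψ]
      _ = ∑ i, ∑ j, star (P i *ᵥ ψ) ⬝ᵥ (P j *ᵥ ψ) := by
          rw [star_sum, sum_dotProduct]
          exact Finset.sum_congr rfl fun i _ => dotProduct_sum _ _ _
      _ = ∑ j, star (P j *ᵥ ψ) ⬝ᵥ (P j *ᵥ ψ) := by
          refine Finset.sum_congr rfl fun i _ => ?_
          rw [Finset.sum_eq_single i (fun j _ hj => horth i j (Ne.symm hj) ψ hψ)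
            (fun h => absurd (Finset.mem_univ i) h)]
  have henergy : star ψ ⬝ᵥ H *ᵥ ψ = ∑ j, star (P j *ᵥ ψ) ⬝ᵥ (H *ᵥ (P j *ᵥ ψ)) := by
    calc star ψ ⬝ᵥ H *ᵥ ψ = star (∑ i, P i *ᵥ ψ) ⬝ᵥ (H *ᵥ ∑ j, P j *ᵥ ψ) := by rw [hsum ψ hψ]
      _ = ∑ i, ∑ j, star (P i *ᵥ ψ) ⬝ᵥ (H *ᵥ (P j *ᵥ ψ)) := by
          rw [mulVec_sum, star_sum, sum_dotProduct]
          exact Finset.sum_congr rfl fun i _ => dotProduct_sum _ _ _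
      _ = ∑ j, star (P j *ᵥ ψ) ⬝ᵥ (H *ᵥ (P j *ᵥ ψ)) := by
          refine Finset.sum_congr rfl fun i _ => ?_
          rw [Finset.sum_eq_single i (fun j _ hj => hblock i j (Ne.symm hj) ψ hψ)
            (fun h => absurd (Finset.mem_univ i) h)]
  rw [hnorm, henergy, Complex.re_sum, Complex.re_sum, Finset.mul_sum]
  refine Finset.sum_le_sum fun j _ => ?_
  by_cases hj : j = j₀
  · subst hj; exact hj₀ ψ hψ hΩ₀
  · exact hother j hj ψ hψ

/-- **The gap on `Ω^⊥` survives a form-bounded perturbation**, losing the form bound: if `H₀`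
is `≥ E₁` on `Ω^⊥ ∩ K` and `V ≥ -ε` on `K` (as quadratic forms), then `H₀ + V ≥ E₁ - ε` on
`Ω^⊥ ∩ K`. [folklore] -/
theorem gap_orthogonal_add_of_form_bound (H₀ V : Matrix ι ι ℂ) (K : Submodule ℂ (ι → ℂ))
    (Ω : ι → ℂ) {E₁ ε : ℝ}
    (hgap : ∀ ψ ∈ K, star Ω ⬝ᵥ ψ = 0 → E₁ * (star ψ ⬝ᵥ ψ).re ≤ (star ψ ⬝ᵥ H₀ *ᵥ ψ).re)
    (hV : ∀ ψ ∈ K, -ε * (star ψ ⬝ᵥ ψ).re ≤ (star ψ ⬝ᵥ V *ᵥ ψ).re) :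
    ∀ ψ ∈ K, star Ω ⬝ᵥ ψ = 0 →
      (E₁ - ε) * (star ψ ⬝ᵥ ψ).re ≤ (star ψ ⬝ᵥ (H₀ + V) *ᵥ ψ).re := by
  intro ψ hψ hΩ
  rw [add_mulVec, dotProduct_add, Complex.add_re, sub_mul]
  have h1 := hgap ψ hψ hΩ
  have h2 := hV ψ hψ
  rw [neg_mul] at h2
  linarith

/-- **Variational shift of a sector energy under a form-bounded perturbation**: if `H₀` has an
eigenvector in `K` at its sector energy `E₀ = H₀.minEnergyOn K` (a sector ground state) and
`V ≤ ε` on `K` as a quadratic form, then the sector energy of the Hermitian `H₀ + V` is at most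
`E₀ + ε` (test `H₀ + V` with the normalised ground state of `H₀`). [folklore] -/
theorem minEnergyOn_add_le_of_eigenvector (H₀ V : Matrix ι ι ℂ) (hHV : (H₀ + V).IsHermitian)
    (K : Submodule ℂ (ι → ℂ)) {ε : ℝ}
    (hV : ∀ ψ ∈ K, (star ψ ⬝ᵥ V *ᵥ ψ).re ≤ ε * (star ψ ⬝ᵥ ψ).re)
    {ψ₀ : ι → ℂ} (hψ₀K : ψ₀ ∈ K) (hψ₀ : ψ₀ ≠ 0)
    (heig : H₀ *ᵥ ψ₀ = ((H₀.minEnergyOn K : ℝ) : ℂ) • ψ₀) :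
    (H₀ + V).minEnergyOn K ≤ H₀.minEnergyOn K + ε := by
  classical
  obtain ⟨c, -, hc1⟩ := exists_smul_unit hψ₀
  have hφK : c • ψ₀ ∈ K := K.smul_mem c hψ₀K
  have hφeig : H₀ *ᵥ (c • ψ₀) = ((H₀.minEnergyOn K : ℝ) : ℂ) • (c • ψ₀) := by
    rw [mulVec_smul, heig, smul_comm]
  have hvar := minEnergyOn_le_rayleigh_of_mem hHV K hφK hc1
  have hsplit : (star (c • ψ₀) ⬝ᵥ (H₀ + V) *ᵥ (c • ψ₀)).re =
      H₀.minEnergyOn K + (star (c • ψ₀) ⬝ᵥ V *ᵥ (c • ψ₀)).re := by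
    rw [add_mulVec, dotProduct_add, Complex.add_re, hφeig, dotProduct_smul, hc1, smul_eq_mul,
      mul_one, Complex.ofReal_re]
  have hVφ := hV _ hφK
  rw [hc1, Complex.one_re, mul_one] at hVφ
  linarith

end Generic

/-! ### Sector ground states of `IsGroundStateInSector` -/

section Sector

variable {Λ : Type*} [LinearOrder Λ] [Fintype Λ]

/-- **Unique sector ground state from a gap on `Ω^⊥`.** For any operator `H` on Fock space, any
sector `(N, S^z = M)`, any vector `Ω` and any level `E₁` STRICTLY ABOVE the sector energy
`H.minEnergyOn (szSector N M)`: if `E₁ ‖ψ‖² ≤ Re ⟨ψ, H ψ⟩` for every `ψ` of the sector orthogonal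
to `Ω`, then the sector ground state (`IsGroundStateInSector`) is unique up to a scalar. This is
the form in which a Feshbach / trial-state argument concludes clause (b) of `CooperPairDMott`
(`Ω` = the dressed zero-momentum pair state, `E₁ − E₀` = the pair-band curvature gap). [folklore] -/
theorem isGroundStateInSector_unique_of_gap_orthogonal
    (H : Matrix (Finset (Orb Λ)) (Finset (Orb Λ)) ℂ) (N : ℕ) (M : ℝ) (Ω : Fock (Orb Λ)) (E₁ : ℝ)
    (hE₁ : H.minEnergyOn (szSector N M) < E₁)
    (hgap : ∀ ψ ∈ szSector N M, star Ω ⬝ᵥ ψ = 0 →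
      E₁ * (star ψ ⬝ᵥ ψ).re ≤ (star ψ ⬝ᵥ H *ᵥ ψ).re) :
    ∀ φ₁ φ₂, IsGroundStateInSector H N M φ₁ → IsGroundStateInSector H N M φ₂ →
      ∃ c : ℂ, φ₂ = c • φ₁ :=
  fun _ _ h₁ h₂ =>
    eq_smul_of_eigenvector_of_gap_orthogonal H (szSector N M) hE₁ Ω hgap h₁.1 h₂.1 h₁.2.1
      h₁.2.2 h₂.2.2

/-- **Uniqueness is an open condition in the couplings (at FIXED size).** If `H₀` has a sector
ground state, its quadratic form is `≥ E₁` on the part of the sector orthogonal to `Ω`, and the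
perturbation `V` satisfies `-ε ≤ V ≤ ε` on the sector (as forms) with `E₀ + 2ε < E₁`
(`E₀ = H₀.minEnergyOn`), then the Hermitian `H₀ + V` still has a unique sector ground state.
CAVEAT for `CooperPairDMott` (b): this cannot reach `b → 0` at fixed `L`, where the unperturbed
two-hole level is `(L/2)²`-fold degenerate (`E₁ = E₀` at `b = 0`); and at fixed `b > 0` the margin
`E₁ - E₀ ∼ b²/L²` only tolerates perturbations of form-norm `o(b²/L²)`, while the inter-plaquette
hopping has norm `∼ b L²` — which is exactly why an `L`-uniform effective-Hamiltonian argument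
(not a norm estimate) is required. [folklore] -/
theorem isGroundStateInSector_unique_of_gap_orthogonal_add
    (H₀ V : Matrix (Finset (Orb Λ)) (Finset (Orb Λ)) ℂ) (hHV : (H₀ + V).IsHermitian) (N : ℕ) (M : ℝ)
    (Ω : Fock (Orb Λ)) {E₁ ε : ℝ} (hex : ∃ ψ₀, IsGroundStateInSector H₀ N M ψ₀)
    (hgap : ∀ ψ ∈ szSector N M, star Ω ⬝ᵥ ψ = 0 →
      E₁ * (star ψ ⬝ᵥ ψ).re ≤ (star ψ ⬝ᵥ H₀ *ᵥ ψ).re)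
    (hV₁ : ∀ ψ ∈ szSector N M, (star ψ ⬝ᵥ V *ᵥ ψ).re ≤ ε * (star ψ ⬝ᵥ ψ).re)
    (hV₂ : ∀ ψ ∈ szSector N M, -ε * (star ψ ⬝ᵥ ψ).re ≤ (star ψ ⬝ᵥ V *ᵥ ψ).re)
    (hε : H₀.minEnergyOn (szSector N M) + 2 * ε < E₁) :
    ∀ φ₁ φ₂, IsGroundStateInSector (H₀ + V) N M φ₁ → IsGroundStateInSector (H₀ + V) N M φ₂ →
      ∃ c : ℂ, φ₂ = c • φ₁ := by
  obtain ⟨ψ₀, hψ₀K, hψ₀, heig⟩ := hex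
  have hmin : (H₀ + V).minEnergyOn (szSector N M) ≤ H₀.minEnergyOn (szSector N M) + ε :=
    minEnergyOn_add_le_of_eigenvector H₀ V hHV _ hV₁ hψ₀K hψ₀ heig
  exact isGroundStateInSector_unique_of_gap_orthogonal (H₀ + V) N M Ω (E₁ - ε) (by linarith)
    (gap_orthogonal_add_of_form_bound H₀ V _ Ω hgap hV₂)

end Sector

/-! ### The reduction of stub U (`stub_uniqueTwoHoleGroundState`) to an `L`-uniform gap above
### one trial state -/

/-- **Clause (b) of `CooperPairDMott` from a gap above a trial pair state.** With the breathing
torus `Hb L 1 b U` of the route and the verbatim quantifier prefix of `stub_uniqueTwoHoleGroundState`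
(`∀ U ∈ [2,4] ∃ b₀ ∀ b ∈ (0,b₀) ∃ k₀ ∀ k ≥ k₀`, `L = 4k+4`): IF at each such `(U, b, k)` there are a
vector `Ω` (any vector: the intended one is the dressed zero-momentum superposition of the `(L/2)²`
one-plaquette pairs) and a level `E₁ > E(L²−2, 0)` with `E₁ ‖ψ‖² ≤ Re ⟨ψ, H ψ⟩` on the part of the
sector `(L²−2, S^z = 0)` orthogonal to `Ω`, THEN the two-hole sector ground state is unique up to a
scalar — literally the statement of stub U. The hypothesis is where the missing engine must
deliver: `E₁ − E₀ ≈ t_pair(U) b² (2π/(L/2))²` closes like `b²/L²`, so the lower bound on `Ω^⊥` has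
to come from an `L`-uniform effective pair-band Hamiltonian (second-order degenerate perturbation
theory with locality control), not from a norm estimate. [folklore] -/
theorem uniqueTwoHoleGroundState_of_gap_orthogonal : (let Hb := fun (L : ℕ) (a b U : ℝ) => hamiltonian (fermionTorusGraph 2 L \ (⊤ : SimpleGraph (Fin 2 → ℕ)).comap (fun (x : FermionTorus 2 L) (i : Fin 2) => (ofLex x i : ℕ) / 2)) a U + hamiltonian (fermionTorusGraph 2 L ⊓ (⊤ : SimpleGraph (Fin 2 → ℕ)).comap (fun (x : FermionTorus 2 L) (i : Fin 2) => (ofLex x i : ℕ) / 2)) b 0; ∀ U ∈ Set.Icc (2 : ℝ) 4, ∃ b₀ > (0 : ℝ), ∀ b ∈ Set.Ioo 0 b₀, ∃ k₀ : ℕ, ∀ k ≥ k₀, ∃ (Ω : Fock (Orb (FermionTorus 2 (4 * k + 4)))) (E₁ : ℝ), (Hb (4 * k + 4) 1 b U).minEnergyOn (szSector ((4 * k + 4) ^ 2 - 2) 0) < E₁ ∧ ∀ ψ ∈ szSector ((4 * k + 4) ^ 2 - 2) 0, star Ω ⬝ᵥ ψ = 0 → E₁ * (star ψ ⬝ᵥ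 ψ).re ≤ (star ψ ⬝ᵥ (Hb (4 * k + 4) 1 b U) *ᵥ ψ).re) → (let Hb := fun (L : ℕ) (a b U : ℝ) => hamiltonian (fermionTorusGraph 2 L \ (⊤ : SimpleGraph (Fin 2 → ℕ)).comap (fun (x : FermionTorus 2 L) (i : Fin 2) => (ofLex x i : ℕ) / 2)) a U + hamiltonian (fermionTorusGraph 2 L ⊓ (⊤ : SimpleGraph (Fin 2 → ℕ)).comap (fun (x : FermionTorus 2 L) (i : Fin 2) => (ofLex x i : ℕ) / 2)) b 0; ∀ U ∈ Set.Icc (2 : ℝ) 4, ∃ b₀ > (0 : ℝ), ∀ b ∈ Set.Ioo 0 b₀, ∃ k₀ : ℕ, ∀ k ≥ k₀, ∀ φ₁ φ₂, IsGroundStateInSector (Hb (4 * k + 4) 1 b U) ((4 * k + 4) ^ 2 - 2) 0 φ₁ → IsGroundStateInSector (Hb (4 * k + 4) 1 b U) ((4 * k + 4) ^ 2 - 2) 0 φ₂ → ∃ c : ℂ, φ₂ = c • φ₁) := by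
  intro h
  dsimp only at h ⊢
  intro U hU
  obtain ⟨b₀, hb₀, hb⟩ := h U hU
  refine ⟨b₀, hb₀, fun b hbI => ?_⟩
  obtain ⟨k₀, hk⟩ := hb b hbI
  refine ⟨k₀, fun k hkk => ?_⟩
  obtain ⟨Ω, E₁, hE₁, hgap⟩ := hk k hkk
  exact isGroundStateInSector_unique_of_gap_orthogonal _ _ _ Ω E₁ hE₁ hgap

end Summit.HubbardSuperconductivity.HubbardSuperconductivity.Theorems.CooperPairDMottWalk
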